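import Summits.QuantumFields.YangMills.Theorems.UnitScaleTiltProp7OneFormDecayLetters
import Summits.QuantumFields.YangMills.Theorems.UnitScaleTiltProp7BlockDistanceWeights
import HarnessLib

/-!
# Route `UnitScaleTilt`, crux K1 «MinimiserStabilityRegPr» (stmt-QuantumFields-19200), EX face S46 — (L3′b), ONE-FORM STOREY, FILE O4c:
# **THE DECAYED DATA LETTERS OF O4 — `hf` FROM BLOCK SUPPORT AND `hEW` FROM THE `L²` BLOCK DECAY OF THE SOLUTION** (the two-rate bracket on the coarse torus)

Cell `ym3-torus` (HUMAN RULING D-0037; rung R3 = SU(2) YM₃ on T³ — NOT d = 4, NOT infinite volume, NOT a mass gap, NOT Clay).  Chair seat ★`ym-ust-19200-p1` g26, own pen O4c.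
THEOREMS ONLY (0 `def`, 0 `sorry`, default heartbeats); `--supports stmt-QuantumFields-19200 --as helper`; count-neutral.

WHAT IS PROVED (ns `Summit.QuantumFields.YangMills.Theorems.Prop7OneFormDecayData`).
* §1 `norm_le_mul_exp_neg_of_support` — a function vanishing off `{d = 0}` and bounded by `F` is bounded by `F·e^{−κd}` (the `hf` letter of O4 for a block-supported source).
* §2 ★★★ `sqrt_sum_normSq_div_weight_le_of_blockDecay` — THE `E_W` LETTER OF O4: if the weight at centre `p₁` has the FLOOR `c_W·e^{κ·tdist(B p₁, B p)} ≤ W p` (O4b ✓-typed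
  `exists_coshFamily`), and the solution has the `L²` BLOCK DECAY `‖1_y u‖ ≤ D₀·e^{−r·tdist(y, v)}` (A4 ✓`blockDecay_oneForm_of_letters` per block) with `κ < 2r`, then
  `√(Σ_p c₀‖u(p)‖²∕W p) ≤ √(c_W⁻¹·(2(1 + 1∕(2r − κ)))³)·D₀·e^{−(κ∕2)·tdist(B p₁, v)}` — O4a ✓`sum_normSq_div_weight_le_of_blocks` + the triangle inequality and the K-free exponential
  volume of the coarse torus (px12 ✓`Prop7BlockDistanceWeights`).  The rate HALVES (two-rate bracket), as in print's (3.46)→(3.42).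
HONEST SCOPE.  Bookkeeping on displayed letters; nothing of the ten EX rows, `hT`, (3.42), EX or the crux is proved here.

References: T. Bałaban, CMP **99** (1985) 389–434 [Balaban1985BackgroundPropagators] (Thm 3.1 (3.42) p.397, (3.46) p.398, (3.49) p.399); CMP **95** (1984) 17–40
[Balaban1984PropagatorsI] (Prop. 1.1 p.33).
-/

set_option autoImplicit false

noncomputable section

open scoped Matrix.Norms.L2Operator BigOperators InnerProductSpace ComplexConjugate

namespace Summit.QuantumFields.YangMills.Theorems.Prop7OneFormDecayData

open Literature.MathematicalPhysics.QuantumFieldTheory.Balaban1983to89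
open Literature.MathematicalPhysics.QuantumFieldTheory.Balaban1983to89.T3ContinuumYM3Torus
open B4Sect5Torus (TSite)
open B9SectCLatticeCarrier (Bond)
open B9Eq311L2Pairing (WL2)
open B11Eq103H1Complex (BondL2K)
open B5Eq118OneStroke (iterBlockOf)
open Summit.QuantumFields.YangMills.Theorems.Prop7SectET3Transport (periodsT3 bondEquiv)
open Summit.QuantumFields.YangMills.Theorems.Prop7SectET3HilbertLetters (W₂ toL2)
open Summit.QuantumFields.YangMills.Theorems.Prop7BlockDistanceWeights (sum_exp_neg_mul_tdist_coarse_le tdist_coarse_triangle tdist_coarse_comm)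
open Summit.QuantumFields.YangMills.Theorems.Prop7OneFormDecayLetters (sum_normSq_div_weight_le_of_blocks)

/-! ## §1 The source letter from block support -/

/-- **THE `hf` LETTER FROM SUPPORT**: if `g` vanishes wherever `d ≠ 0` and `‖g‖ ≤ F` everywhere, then `‖g(p)‖ ≤ F·e^{−κ·d(p)}` for every rate `κ`. [folklore]
[cite: Balaban1985BackgroundPropagators, Thm 3.1 (3.42) p.397] -/
theorem norm_le_mul_exp_neg_of_support {ι E : Type*} [SeminormedAddCommGroup E] (g : ι → E) (d : ι → ℝ) (κ : ℝ) {Fb : ℝ}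
    (hF : ∀ p, ‖g p‖ ≤ Fb) (hsupp : ∀ p, g p ≠ 0 → d p = 0) (p : ι) : ‖g p‖ ≤ Fb * Real.exp (-(κ * d p)) := by
  by_cases hp : g p = 0
  · rw [hp, norm_zero]
    exact mul_nonneg ((norm_nonneg _).trans (hF p)) (Real.exp_pos _).le
  · rw [hsupp p hp, mul_zero, neg_zero, Real.exp_zero, mul_one]; exact hF p

/-! ## §2 The `E_W` letter from the `L²` block decay -/

variable {F : T3Family} {n K : ℕ} {c₀ : ℝ} [Fact (0 < c₀)]

/-- ★★★ **THE `E_W` LETTER OF O4 FROM THE `L²` BLOCK DECAY (two-rate bracket).**  Weight `W` on bonds with the FLOOR `c_W·e^{κ·tdist(B₁, B(p))} ≤ W(p)` against a base block `B₁`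
(`B(p) = iterBlockOf (K − n) ((bondEquiv)⁻¹p).src`), solution `u` with `‖1_{B = y} u‖ ≤ D₀·e^{−r·tdist(y, v)}` for every block `y`, and `κ < 2r`.  THEN
`√(Σ_p c₀‖u(p)‖²∕W(p)) ≤ √(c_W⁻¹·(2(1 + 1∕(2r − κ)))³)·D₀·e^{−(κ∕2)·tdist(B₁, v)}`.  (O4a ✓`sum_normSq_div_weight_le_of_blocks` with `m(y) = c_W e^{κ·tdist(B₁,y)}`; then
`e^{−κ·tdist(B₁,y)} ≤ e^{−κ·tdist(B₁,v)}·e^{κ·tdist(y,v)}` and ✓`sum_exp_neg_mul_tdist_coarse_le` at rate `2r − κ`.)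
[cite: Balaban1985BackgroundPropagators, (3.46) p.398, Thm 3.1 (3.42) p.397; Balaban1984PropagatorsI, Prop. 1.1 p.33] -/
theorem sqrt_sum_normSq_div_weight_le_of_blockDecay (u : BondL2K ℂ 3 (periodsT3 F K) c₀ W₂) (W : Bond 3 (periodsT3 F K) → ℝ)
    (B₁ v : Site (F.P K) (K - n)) {κ cW D₀ r : ℝ} (hκ : 0 ≤ κ) (hcW : 0 < cW) (hD₀ : 0 ≤ D₀) (hr : κ < 2 * r)
    (hWfloor : ∀ p : Bond 3 (periodsT3 F K),
      cW * Real.exp (κ * (Site.tdist B₁ (iterBlockOf (K - n) ((bondEquiv F K).symm p).src) : ℝ)) ≤ W p)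
    (hD : ∀ y : Site (F.P K) (K - n),
      ‖toL2 F K c₀ (fun b => if iterBlockOf (K - n) b.src = y then (toL2 F K c₀).symm u b else 0)‖ ≤ D₀ * Real.exp (-(r * (Site.tdist y v : ℝ)))) :
    Real.sqrt (∑ p : Bond 3 (periodsT3 F K), c₀ * ‖WL2.equiv ℂ _ W₂ u p‖ ^ 2 / W p)
      ≤ Real.sqrt (cW⁻¹ * (2 * (1 + 1 / (2 * r - κ))) ^ 3) * D₀ * Real.exp (-(κ / 2 * (Site.tdist B₁ v : ℝ))) := by
  -- Step 1: O4a's block comparison with `m y := c_W e^{κ tdist(B₁, y)}`, `D y := D₀ e^{−r tdist(y, v)}`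
  have h1 := sum_normSq_div_weight_le_of_blocks (n := n) u W (fun y => cW * Real.exp (κ * (Site.tdist B₁ y : ℝ)))
    (fun y => D₀ * Real.exp (-(r * (Site.tdist y v : ℝ)))) (fun y => by positivity) hWfloor hD
  -- Step 2: each block term against the two-rate bracket
  have hνpos : 0 < 2 * r - κ := by linarith
  have h2 : ∀ y : Site (F.P K) (K - n),
      (D₀ * Real.exp (-(r * (Site.tdist y v : ℝ)))) ^ 2 / (cW * Real.exp (κ * (Site.tdist B₁ y : ℝ)))
        ≤ D₀ ^ 2 * cW⁻¹ * Real.exp (-(κ * (Site.tdist B₁ v : ℝ))) * Real.exp (-((2 * r - κ) * (Site.tdist y v : ℝ))) := by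
    intro y
    have htri : (Site.tdist B₁ v : ℝ) ≤ (Site.tdist B₁ y : ℝ) + (Site.tdist y v : ℝ) := tdist_coarse_triangle (F := F) B₁ y v
    have e1 : (D₀ * Real.exp (-(r * (Site.tdist y v : ℝ)))) ^ 2 / (cW * Real.exp (κ * (Site.tdist B₁ y : ℝ)))
        = D₀ ^ 2 * cW⁻¹ * Real.exp (-(2 * r * (Site.tdist y v : ℝ)) - κ * (Site.tdist B₁ y : ℝ)) := by
      rw [mul_pow, ← Real.exp_nat_mul, Real.exp_sub, div_eq_mul_inv, mul_inv]
      push_cast; ring_nf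
    have e2 : D₀ ^ 2 * cW⁻¹ * Real.exp (-(κ * (Site.tdist B₁ v : ℝ))) * Real.exp (-((2 * r - κ) * (Site.tdist y v : ℝ)))
        = D₀ ^ 2 * cW⁻¹ * Real.exp (-(κ * (Site.tdist B₁ v : ℝ)) - (2 * r - κ) * (Site.tdist y v : ℝ)) := by
      rw [Real.exp_sub, Real.exp_neg ((2 * r - κ) * _), div_eq_mul_inv]; ring
    rw [e1, e2]
    refine mul_le_mul_of_nonneg_left (Real.exp_le_exp.mpr ?_) (by positivity)
    nlinarith [mul_le_mul_of_nonneg_left htri hκ]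
  -- Step 3: sum, K-free coarse volume
  have hvol := sum_exp_neg_mul_tdist_coarse_le (F := F) (n := n) (K := K) hνpos v
  have h3 : ∑ p : Bond 3 (periodsT3 F K), c₀ * ‖WL2.equiv ℂ _ W₂ u p‖ ^ 2 / W p
      ≤ D₀ ^ 2 * cW⁻¹ * Real.exp (-(κ * (Site.tdist B₁ v : ℝ))) * (2 * (1 + 1 / (2 * r - κ))) ^ 3 := by
    refine h1.trans ((Finset.sum_le_sum fun y _ => h2 y).trans ?_)
    rw [← Finset.mul_sum]
    exact mul_le_mul_of_nonneg_left hvol (by positivity)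
  -- Step 4: square roots
  set A : ℝ := cW⁻¹ * (2 * (1 + 1 / (2 * r - κ))) ^ 3 with hAdef
  have hA : 0 ≤ A := by positivity
  have he2 : Real.exp (-(κ / 2 * (Site.tdist B₁ v : ℝ))) ^ 2 = Real.exp (-(κ * (Site.tdist B₁ v : ℝ))) := by
    rw [sq, ← Real.exp_add]; ring_nf
  have hR : D₀ ^ 2 * cW⁻¹ * Real.exp (-(κ * (Site.tdist B₁ v : ℝ))) * (2 * (1 + 1 / (2 * r - κ))) ^ 3
      = (Real.sqrt A * D₀ * Real.exp (-(κ / 2 * (Site.tdist B₁ v : ℝ)))) ^ 2 := by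
    rw [show (Real.sqrt A * D₀ * Real.exp (-(κ / 2 * (Site.tdist B₁ v : ℝ)))) ^ 2
        = Real.sqrt A ^ 2 * D₀ ^ 2 * Real.exp (-(κ / 2 * (Site.tdist B₁ v : ℝ))) ^ 2 by ring, Real.sq_sqrt hA, he2, hAdef]
    ring
  calc Real.sqrt (∑ p : Bond 3 (periodsT3 F K), c₀ * ‖WL2.equiv ℂ _ W₂ u p‖ ^ 2 / W p)
      ≤ Real.sqrt ((Real.sqrt A * D₀ * Real.exp (-(κ / 2 * (Site.tdist B₁ v : ℝ)))) ^ 2) :=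
        Real.sqrt_le_sqrt (h3.trans_eq hR)
    _ = _ := Real.sqrt_sq (by positivity)

end Summit.QuantumFields.YangMills.Theorems.Prop7OneFormDecayData

end
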